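/-
Copyright (c) 2026 the pub-hodgecm-mathlib formalisation cell (harness21).  Prover seat hodgecm-mathlib-K2E4-p23 (g2), Track B ∕ K2-LIT, h413 =
`stmt-HodgeConjecture-24833`, ENGINE E1, 5Res campaign «ENDGAME BY FAMILIES», ROADCARD §3′ (M2 v2, amendment #2), deal (239)(β) of K2E1-plan (g7): the E1 INSTANTIATION
SKELETON of ★ D5′ proper at `U(H)(𝔸_{L⁺})` (★ `cmDatum L N H`, every `N`, every `H`; the dealt instance is `N = 2`, `H = J₂`), hypothesis-first on the model letters.
-/
import Summits.HodgeConjecture.HodgeConjecture.Theorems.K2E1IrreducibleNoContinuousSpectrumU   -- ★ p860349 (this seat) D5′ proper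
import Summits.HodgeConjecture.HodgeConjecture.Theorems.K2E1HeckeAlgebraLettersCM             -- ★ (K2E2-p12, deal (241)): `hnd`, `hAW`, block-projector letters at `cmDatum`; brings ★ p860333 `K2E1PureTensorHeckeAlgebraU` ((A1)(A3))
import HarnessLib

/-!
# K2·E1 — `K2E1IrreducibleNoContinuousSpectrumCMTwoOfLetters`: ★ D5′ PROPER AT `U(H)(𝔸_{L⁺})` WITH THE ALGEBRA LETTERS PLUGGED — «AN IRREDUCIBLE SUMMAND HAS NO CONTINUOUS SPECTRUM
# AT THE BLOCK `P = P_χ ∘ R_f(e)`», hypothesis-first on the MODEL letters (ROADCARD §3′.1 (ii′)(iii′), deal (239)(β); every `N`, every `H` — the dealt instance is `N = 2`, `H = J₂`)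

Track B ∕ K2-LIT, crux h413 = `stmt-HodgeConjecture-24833`, route of record `HCCMUnconditional`; cell `hodgecm-mathlib`, squad K2, ENGINE E1 (5Res campaign, M2 v2).  Prover seat
`hodgecm-mathlib-K2E4-p23` (g2); deal (239)(β).  THEOREMS ONLY (no `def`, no `instance`, no notation, no named-fact hypothesis, no `sorry`); lane
`--supports stmt-HodgeConjecture-24833 --as helper` (count-neutral).  CLOSES NO SOCKET.

WHAT IS PLUGGED (★, by name) into ★ `indicator_lpSMul_proj_eq_zero_of_irreducible_subrep`: `π` ANY unitary strongly continuous representation of `U(H)(𝔸_{L⁺}) = (cmDatum L N H).Adelic` on a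
Hilbert space `V` (E1: `R` on `L²` ∕ on `(L²_cusp)ᗮ`); `𝓐` := the PURE TENSORS `{π_∞(a) ∘L π_f(b)}` (★ p860333): (A1) `cm_comp_pureTensor_mem`, (A3) `cm_adjoint_pureTensor_mem`, (A2)
`cm_pureTensor_nondegenerate`, `hAW` `cm_pureTensor_apply_mem` (★ `K2E1HeckeAlgebraLettersCM`); the block projector `P = P_χ ∘L R_f(e)` with `V_P := {v | P v = v}`: `hPV hPsa hPW`
`cm_blockProjector_hPV ∕ _hPsa ∕ _hPW`, `hPid` `apply_eq_of_mem_eqLocus`, `hVc` `isClosed_eqLocus_id`.  `hTV` is DERIVED here from `hTP : Commute P (T j)`; `hTW` from `hAW`.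
THE REMAINING LETTERS (= the D-road bill, visible binders): (L1) `T : J → V →L V` with `hT𝓐 : T j ∈ 𝓐` (E1: `T_j = R_∞(h_j) ∘L R_f(e)`), `hTP : Commute P (T j)` (★ (S2) `commute_pureTensor_of_separate`
given the τ-spherical commutation `hcommTau` of K2E2-p12's `K2E1TauSphericalHecke…` §1), `hTB` «`T_j|_{V_P}` commutes with the compressions» (payer: the model, D4′c+D4′d); (L2) the MODEL `U : V →ₗ[ℂ] Lp E 2 m`
(per (242): `U := WithLp.snd ∘ U_SD ∘ P_{Sc}` for a self-dual family, ★ p860386; `U_OD` for off-dual), symbols `s j` with `hs` and the intertwining `hU : U (T j v) = s_j • U v` on `V_P` (payer D4′b-2 =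
★ `K2E1ArchCentralSymbolActionU2.isometry_map_eq_map_isometry` + the Gram letter of D4′d); (L3) `hline` (payer ★ (α) `K2E1AnalyticLevelSetNullU.volume_levelSet_axis_eq_zero` + one non-constant
symbol ★ p860148∕`exists_symbol_ne_of_re_ge_half`).
HEADS: **`indicator_lpSMul_blockProj_eq_zero_of_irreducible_subrep_cm`** (general line part `Λ`) and **`lpModel_blockProj_eq_zero_of_irreducible_subrep_cm`** (`Λ = univ`: `U (P w) = 0` — the
line coordinate of the model of the block projection of every vector of every irreducible closed summand VANISHES).
HONEST LABEL: HC_CM is proved only modulo the 7 printed citations (2 remaining named inputs: hLiu418 = `stmt-HodgeConjecture-24832`, h413 = `stmt-HodgeConjecture-24833`) until rung 0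
closes; this file asserts no named fact, is conditional by construction on the visible letters (L1)–(L3), and closes no socket; count-neutral.

## References
* [MoeglinWaldspurger1995] C. Mœglin, J.-L. Waldspurger, *Spectral decomposition and Eisenstein series* (1995), IV.3.12 (b), VI.2.
* [DeitmarEchterhoff2014] A. Deitmar, S. Echterhoff, *Principles of Harmonic Analysis* (2014), Prop. 6.2.1, Lemma 6.1.7, §9.2.
* [Knapp1986] A. W. Knapp, *Representation Theory of Semisimple Groups* (1986), VIII §3.
-/

set_option autoImplicit false
-- the mandated namespace repeats the single-problem summit's segment (`HodgeConjecture.HodgeConjecture`)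
set_option linter.dupNamespace false

noncomputable section

open MeasureTheory Filter Topology CompactlySupported NumberField ContRepresentation Set
open scoped InnerProductSpace ENNReal ComplexConjugate
open Literature.NumberTheory.Automorphic Literature.NumberTheory.Automorphic.UnitaryGroup AdelicGroupData
open Summit.HodgeConjecture.HodgeConjecture.Cruxes.H413.K2E1IrreducibleNoContinuousSpectrumU (indicator_lpSMul_proj_eq_zero_of_irreducible_subrep)
open Summit.HodgeConjecture.HodgeConjecture.Cruxes.H413.K2E1HeckeAlgebraLettersCM
open Summit.HodgeConjecture.HodgeConjecture.Cruxes.H413.K2E1PureTensorHeckeAlgebraU (cm_comp_pureTensor_mem cm_adjoint_pureTensor_mem)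
open Summit.HodgeConjecture.HodgeConjecture.Cruxes.H413.K2E1ZeroOneLawSpectralSupport (indicator_lpSMul_eq_self_iff)

namespace Summit.HodgeConjecture.HodgeConjecture.Cruxes.H413.K2E1IrreducibleNoContinuousSpectrumCMTwoOfLetters

variable {L : Type} [Field L] [NumberField L] [IsCMField L] {N : ℕ} {H : Matrix (Fin N) (Fin N) L}
  {K V : Type*} [Group K] [TopologicalSpace K] [MeasurableSpace K] [BorelSpace K]
  [NormedAddCommGroup V] [InnerProductSpace ℂ V] [CompleteSpace V]
  (π : ContRepresentation ℂ (cmDatum L N H).Adelic V) (hu : π.IsUnitary) (hc : π.IsStronglyContinuous)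
  [MeasurableSpace (UnitaryGroup.arch (↥(maximalRealSubfield L)) L (IsCMField.complexConj L) N H)] [BorelSpace (UnitaryGroup.arch (↥(maximalRealSubfield L)) L (IsCMField.complexConj L) N H)]
  [MeasurableSpace (finAdelic (↥(maximalRealSubfield L)) L (IsCMField.complexConj L) N H)] [BorelSpace (finAdelic (↥(maximalRealSubfield L)) L (IsCMField.complexConj L) N H)]
  (νinf : Measure (UnitaryGroup.arch (↥(maximalRealSubfield L)) L (IsCMField.complexConj L) N H)) [IsFiniteMeasureOnCompacts νinf] [νinf.IsMulLeftInvariant] [νinf.IsInvInvariant] [νinf.IsOpenPosMeasure]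
  (νf : Measure (finAdelic (↥(maximalRealSubfield L)) L (IsCMField.complexConj L) N H)) [IsFiniteMeasureOnCompacts νf] [νf.IsMulLeftInvariant] [νf.IsInvInvariant] [νf.IsOpenPosMeasure]
  (κ : K →* UnitaryGroup.arch (↥(maximalRealSubfield L)) L (IsCMField.complexConj L) N H) (hκ : Continuous κ)
  (μ : Measure K) [IsFiniteMeasureOnCompacts μ] [IsProbabilityMeasure μ] [MeasurableMul K] [μ.IsMulLeftInvariant] [MeasurableInv K] [μ.IsInvInvariant]
  (χ : C_c(K, ℂ)) (e : C_c(finAdelic (↥(maximalRealSubfield L)) L (IsCMField.complexConj L) N H, ℂ))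
  {Ω : Type*} {mΩ : MeasurableSpace Ω} {m : Measure Ω} {E : Type*} [NormedAddCommGroup E] [NormedSpace ℂ E] {J : Type*} [Countable J]
variable [ENNReal.HolderTriple ∞ 2 2]

/-- **★ D5′ PROPER AT `U(H)(𝔸_{L⁺})`, ALGEBRA LETTERS PLUGGED** (general line part `Λ`).  For ANY unitary strongly continuous `π` of `U(H)(𝔸_{L⁺})` on `V`, Haar-type measures `ν_∞, ν_f`
(finite on compacta, left- and inversion-invariant, positive on opens), the K-type∕level data `(κ, μ, χ; e, K′)` of the block projector `P = P_χ ∘L R_f(e)` (★ `K2E1HeckeAlgebraLettersCM`),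
Hecke operators `T_j ∈ 𝓐` commuting with `P` and, on `V_P = {P v = v}`, with the compressions (letters `hT𝓐 hTP hTB`), a LINEAR model map `U` with symbols `s_j` (`hs`, `hU`) and the line
letter (hline): for every topologically irreducible closed `W ≤ V` and `w ∈ W`, **`𝟙_Λ • U (P w) = 0`**. [cite: MoeglinWaldspurger1995, IV.3.12, VI.2] [cite: DeitmarEchterhoff2014, Lemma 6.1.7] -/
theorem indicator_lpSMul_blockProj_eq_zero_of_irreducible_subrep_cm
    (hχmul : ∀ k l, χ (k * l) = χ k * χ l) (hχone : χ 1 = 1) (hχinv : ∀ k, conj (χ k⁻¹) = χ k)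
    (K' : Subgroup (finAdelic (↥(maximalRealSubfield L)) L (IsCMField.complexConj L) N H)) (he0 : ∀ x, x ∉ K' → e x = 0) (he1 : ∫ x, e x ∂νf = 1)
    (heK : ∀ k ∈ K', ∀ x, e (k * x) = e x) (hestar : ∀ x, mulStar (⇑e) x = e x)
    (P : V →L[ℂ] V) (hPdef : P = ((π.restrict ((archToAdelic (↥(maximalRealSubfield L)) L (IsCMField.complexConj L) N H).comp κ)).integratedOperator (hu.restrict _)
          (hc.restrict _ ((continuous_archToAdelic (↥(maximalRealSubfield L)) L (IsCMField.complexConj L) N H).comp hκ)) μ χ ∘L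
        (π.restrict (finAdelicToAdelic (↥(maximalRealSubfield L)) L (IsCMField.complexConj L) N H)).integratedOperator (hu.restrict _) (hc.restrict _ (continuous_finAdelicToAdelic (↥(maximalRealSubfield L)) L (IsCMField.complexConj L) N H)) νf e))
    (W : ClosedSubrep π) (hW : W.toContRep.IsTopIrreducible)
    (T : J → V →L[ℂ] V) (hT𝓐 : ∀ j, T j ∈ {A : V →L[ℂ] V | ∃ (a : C_c(UnitaryGroup.arch (↥(maximalRealSubfield L)) L (IsCMField.complexConj L) N H, ℂ)) (b : C_c(finAdelic (↥(maximalRealSubfield L)) L (IsCMField.complexConj L) N H, ℂ)),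
      A = (π.restrict (archToAdelic (↥(maximalRealSubfield L)) L (IsCMField.complexConj L) N H)).integratedOperator (hu.restrict _) (hc.restrict _ (continuous_archToAdelic (↥(maximalRealSubfield L)) L (IsCMField.complexConj L) N H)) νinf a ∘L
          (π.restrict (finAdelicToAdelic (↥(maximalRealSubfield L)) L (IsCMField.complexConj L) N H)).integratedOperator (hu.restrict _) (hc.restrict _ (continuous_finAdelicToAdelic (↥(maximalRealSubfield L)) L (IsCMField.complexConj L) N H)) νf b})
    (hTP : ∀ j, Commute P (T j))
    (hTB : ∀ j, ∀ A ∈ {A : V →L[ℂ] V | ∃ (a : C_c(UnitaryGroup.arch (↥(maximalRealSubfield L)) L (IsCMField.complexConj L) N H, ℂ)) (b : C_c(finAdelic (↥(maximalRealSubfield L)) L (IsCMField.complexConj L) N H, ℂ)),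
      A = (π.restrict (archToAdelic (↥(maximalRealSubfield L)) L (IsCMField.complexConj L) N H)).integratedOperator (hu.restrict _) (hc.restrict _ (continuous_archToAdelic (↥(maximalRealSubfield L)) L (IsCMField.complexConj L) N H)) νinf a ∘L
          (π.restrict (finAdelicToAdelic (↥(maximalRealSubfield L)) L (IsCMField.complexConj L) N H)).integratedOperator (hu.restrict _) (hc.restrict _ (continuous_finAdelicToAdelic (↥(maximalRealSubfield L)) L (IsCMField.complexConj L) N H)) νf b},
      ∀ x ∈ LinearMap.eqLocus (P : V →ₗ[ℂ] V) LinearMap.id, P (A (T j x)) = T j (P (A x)))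
    (U : V →ₗ[ℂ] Lp E 2 m) (s : J → Ω → ℂ) (hs : ∀ j, MemLp (s j) ∞ m)
    (hU : ∀ j, ∀ v ∈ LinearMap.eqLocus (P : V →ₗ[ℂ] V) LinearMap.id, U (T j v) = (hs j).toLp (s j) • U v)
    {Λ : Set Ω} (hΛ : MeasurableSet Λ) (hline : ∀ c : J → ℂ, m (Λ ∩ {x | ∀ j, s j x = c j}) = 0) (hΛ1 : MemLp (Λ.indicator fun _ : Ω => (1 : ℂ)) ∞ m)
    {w : V} (hw : w ∈ W) :
    (hΛ1.toLp (Λ.indicator fun _ : Ω => (1 : ℂ)) • U (P w) : Lp E 2 m) = 0 := by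
  have hPV : ∀ x, P x ∈ LinearMap.eqLocus (P : V →ₗ[ℂ] V) LinearMap.id := fun x => by
    subst hPdef
    exact cm_blockProjector_hPV π hu hc νf κ hκ μ χ e hχmul hχone K' he0 he1 heK x
  have hPid : ∀ v ∈ LinearMap.eqLocus (P : V →ₗ[ℂ] V) LinearMap.id, P v = v := fun v hv => apply_eq_of_mem_eqLocus P v hv
  have hPsa : ∀ x y : V, ⟪P x, y⟫_ℂ = ⟪x, P y⟫_ℂ := fun x y => by
    subst hPdef
    exact cm_blockProjector_hPsa π hu hc νf κ hκ μ χ e hχinv hestar x y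
  have hPW : ∀ w ∈ W, P w ∈ W := fun w hw => by
    subst hPdef
    exact cm_blockProjector_hPW π hu hc νf κ hκ μ χ e W w hw
  have hTV : ∀ j, ∀ x ∈ LinearMap.eqLocus (P : V →ₗ[ℂ] V) LinearMap.id, T j x ∈ LinearMap.eqLocus (P : V →ₗ[ℂ] V) LinearMap.id := fun j x hx => by
    have h := congrArg (fun S : V →L[ℂ] V => S x) (hTP j).eq
    change P (T j x) = T j (P x) at h
    rw [hPid x hx] at h
    exact h
  have hTW : ∀ j, ∀ w ∈ W, T j w ∈ W := fun j w hw => cm_pureTensor_apply_mem π hu hc νinf νf W (T j) (hT𝓐 j) w hw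
  exact indicator_lpSMul_proj_eq_zero_of_irreducible_subrep W hW (cm_comp_pureTensor_mem π hu hc νinf νf) (cm_pureTensor_nondegenerate π hu hc νinf νf)
    (cm_adjoint_pureTensor_mem π hu hc νinf νf) (cm_pureTensor_apply_mem π hu hc νinf νf W)
    (LinearMap.eqLocus (P : V →ₗ[ℂ] V) LinearMap.id) (isClosed_eqLocus_id P) P hPV hPid hPsa hPW T hTV hTW hTB U s hs hU hΛ hline hΛ1 hw

/-- **`Λ = univ`: THE LINE COORDINATE OF THE MODEL VANISHES** — per (242): with `U := WithLp.snd ∘ U_SD ∘ P_{Sc}` (self-dual family, `m` = Lebesgue on `(0,∞)`) or `U := U_OD` (off-dual),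
and `hline : m {∀ j, s_j = c_j} = 0` (★ (α)), every irreducible closed summand has `U (P w) = 0`. [cite: MoeglinWaldspurger1995, IV.3.12, VI.2] -/
theorem lpModel_blockProj_eq_zero_of_irreducible_subrep_cm
    (hχmul : ∀ k l, χ (k * l) = χ k * χ l) (hχone : χ 1 = 1) (hχinv : ∀ k, conj (χ k⁻¹) = χ k)
    (K' : Subgroup (finAdelic (↥(maximalRealSubfield L)) L (IsCMField.complexConj L) N H)) (he0 : ∀ x, x ∉ K' → e x = 0) (he1 : ∫ x, e x ∂νf = 1)
    (heK : ∀ k ∈ K', ∀ x, e (k * x) = e x) (hestar : ∀ x, mulStar (⇑e) x = e x)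
    (P : V →L[ℂ] V) (hPdef : P = ((π.restrict ((archToAdelic (↥(maximalRealSubfield L)) L (IsCMField.complexConj L) N H).comp κ)).integratedOperator (hu.restrict _)
          (hc.restrict _ ((continuous_archToAdelic (↥(maximalRealSubfield L)) L (IsCMField.complexConj L) N H).comp hκ)) μ χ ∘L
        (π.restrict (finAdelicToAdelic (↥(maximalRealSubfield L)) L (IsCMField.complexConj L) N H)).integratedOperator (hu.restrict _) (hc.restrict _ (continuous_finAdelicToAdelic (↥(maximalRealSubfield L)) L (IsCMField.complexConj L) N H)) νf e))
    (W : ClosedSubrep π) (hW : W.toContRep.IsTopIrreducible)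
    (T : J → V →L[ℂ] V) (hT𝓐 : ∀ j, T j ∈ {A : V →L[ℂ] V | ∃ (a : C_c(UnitaryGroup.arch (↥(maximalRealSubfield L)) L (IsCMField.complexConj L) N H, ℂ)) (b : C_c(finAdelic (↥(maximalRealSubfield L)) L (IsCMField.complexConj L) N H, ℂ)),
      A = (π.restrict (archToAdelic (↥(maximalRealSubfield L)) L (IsCMField.complexConj L) N H)).integratedOperator (hu.restrict _) (hc.restrict _ (continuous_archToAdelic (↥(maximalRealSubfield L)) L (IsCMField.complexConj L) N H)) νinf a ∘L
          (π.restrict (finAdelicToAdelic (↥(maximalRealSubfield L)) L (IsCMField.complexConj L) N H)).integratedOperator (hu.restrict _) (hc.restrict _ (continuous_finAdelicToAdelic (↥(maximalRealSubfield L)) L (IsCMField.complexConj L) N H)) νf b})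
    (hTP : ∀ j, Commute P (T j))
    (hTB : ∀ j, ∀ A ∈ {A : V →L[ℂ] V | ∃ (a : C_c(UnitaryGroup.arch (↥(maximalRealSubfield L)) L (IsCMField.complexConj L) N H, ℂ)) (b : C_c(finAdelic (↥(maximalRealSubfield L)) L (IsCMField.complexConj L) N H, ℂ)),
      A = (π.restrict (archToAdelic (↥(maximalRealSubfield L)) L (IsCMField.complexConj L) N H)).integratedOperator (hu.restrict _) (hc.restrict _ (continuous_archToAdelic (↥(maximalRealSubfield L)) L (IsCMField.complexConj L) N H)) νinf a ∘L
          (π.restrict (finAdelicToAdelic (↥(maximalRealSubfield L)) L (IsCMField.complexConj L) N H)).integratedOperator (hu.restrict _) (hc.restrict _ (continuous_finAdelicToAdelic (↥(maximalRealSubfield L)) L (IsCMField.complexConj L) N H)) νf b},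
      ∀ x ∈ LinearMap.eqLocus (P : V →ₗ[ℂ] V) LinearMap.id, P (A (T j x)) = T j (P (A x)))
    (U : V →ₗ[ℂ] Lp E 2 m) (s : J → Ω → ℂ) (hs : ∀ j, MemLp (s j) ∞ m)
    (hU : ∀ j, ∀ v ∈ LinearMap.eqLocus (P : V →ₗ[ℂ] V) LinearMap.id, U (T j v) = (hs j).toLp (s j) • U v)
    (hline : ∀ c : J → ℂ, m {x | ∀ j, s j x = c j} = 0) {w : V} (hw : w ∈ W) :
    U (P w) = 0 := by
  have h1 : MemLp ((univ : Set Ω).indicator fun _ : Ω => (1 : ℂ)) ∞ m := (memLp_top_const (1 : ℂ)).indicator MeasurableSet.univ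
  have h := indicator_lpSMul_blockProj_eq_zero_of_irreducible_subrep_cm π hu hc νinf νf κ hκ μ χ e hχmul hχone hχinv K' he0 he1 heK hestar P hPdef W hW T hT𝓐 hTP hTB U s hs hU
    MeasurableSet.univ (fun c => by rw [univ_inter]; exact hline c) h1 hw
  have hself : (h1.toLp ((univ : Set Ω).indicator fun _ : Ω => (1 : ℂ)) • U (P w) : Lp E 2 m) = U (P w) := by
    rw [indicator_lpSMul_eq_self_iff (U (P w)) MeasurableSet.univ h1, compl_univ, Measure.restrict_empty]
    rw [Filter.EventuallyEq, ae_zero]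
    exact Filter.eventually_bot
  rw [← hself]
  exact h

end Summit.HodgeConjecture.HodgeConjecture.Cruxes.H413.K2E1IrreducibleNoContinuousSpectrumCMTwoOfLetters

end
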